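import Mathlib

/-!
# The integral kernel of a finite-rank operator with continuous range vectors (support, seat p1)

`T7SupportFiniteRankSelfAdjoint` writes a self-adjoint operator of finite rank as `T = ∑ᵢ ⟪φᵢ, ·⟫ ψᵢ` (with
`ψᵢ = T φᵢ`, `φᵢ` an orthonormal basis of the range). On `L²(X, μ)` of a compact space with a finite measure,
and for CONTINUOUS `φᵢ, ψᵢ`, such an operator is an integral operator with the continuous kernel

  `K(x, y) = ∑ᵢ ψᵢ(x) · conj φᵢ(y)`   (`kernel`, `continuous_kernel`):

  `(T f)(x) = ∑ᵢ (∫ conj φᵢ · f dμ) ψᵢ(x) = ∫ K(x, y) f(y) dμ(y)`   for every integrable `f` and EVERY `x`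
  (`op_eq_integral_kernel`; the inner product of `L²` is `∫ conj φ · f`),

and its double period against continuous weights is the finite sum of products of periods

  `∫∫ K(x, y) w_A(x) w_B(y) = ∑ᵢ (∫ ψᵢ w_A) · (∫ conj φᵢ · w_B)`   (`double_integral_kernel`).

This is the bridge from the operator identity of `T7SupportFiniteRankSelfAdjoint` to the kernel equality of
`T7SupportKernelUnique` in the two-kernel derivation of a two-period identity (STATUS l. 14985 (2)(b)–(c)): the
finite spectral kernel `Σ_φ (R(f)φ)(x) conj φ(y)` is continuous, represents `R(f)` pointwise, and its
`[T_A] × [T_B]` double period is `Σ_φ P_A(R(f)φ) conj P_B(φ)`. Nothing here is about any group or any period.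

Blind lane: Mathlib only; no sorry; axioms ⊆ {propext, Classical.choice, Quot.sound}.
-/

namespace Summit.Ventures.HodgeRepro2.T7SupportFiniteRankKernel

open MeasureTheory Finset

variable {X : Type*} [TopologicalSpace X] [CompactSpace X] [MeasurableSpace X] [OpensMeasurableSpace X]
  (μ : Measure X) [IsFiniteMeasure μ] {ι : Type*} [Fintype ι]

omit [MeasurableSpace X] [OpensMeasurableSpace X] in
/-- a continuous function on a compact space is bounded -/
theorem exists_bound_of_continuous (g : X → ℂ) (hg : Continuous g) : ∃ C : ℝ, ∀ x, ‖g x‖ ≤ C :=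
  ⟨‖BoundedContinuousFunction.mkOfCompact ⟨g, hg⟩‖, fun x =>
    BoundedContinuousFunction.norm_coe_le_norm (BoundedContinuousFunction.mkOfCompact ⟨g, hg⟩) x⟩

omit [IsFiniteMeasure μ] in
/-- a continuous function times an integrable one is integrable (compact `X`) -/
theorem integrable_continuous_mul (g f : X → ℂ) (hg : Continuous g) (hf : Integrable f μ) :
    Integrable (fun y => g y * f y) μ := by
  obtain ⟨C, hC⟩ := exists_bound_of_continuous g hg
  exact hf.bdd_mul hg.aestronglyMeasurable (Filter.Eventually.of_forall hC)

/-- a continuous function on a compact space is integrable for a finite measure -/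
theorem integrable_of_continuous (g : X → ℂ) (hg : Continuous g) : Integrable g μ :=
  hg.integrable_of_hasCompactSupport (HasCompactSupport.of_compactSpace g)

/-! ### The kernel and the operator -/

/-- the finite-rank kernel `K(x, y) = ∑ᵢ ψᵢ(x) conj φᵢ(y)` -/
def kernel (φ ψ : ι → X → ℂ) (x y : X) : ℂ := ∑ i, ψ i x * (starRingEnd ℂ) (φ i y)

/-- the finite-rank operator `f ↦ ∑ᵢ (∫ conj φᵢ · f) ψᵢ` (`∫ conj φ · f` = the `L²` inner product `⟪φ, f⟫`) -/
noncomputable def op (φ ψ : ι → X → ℂ) (f : X → ℂ) (x : X) : ℂ :=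
  ∑ i, (∫ y, (starRingEnd ℂ) (φ i y) * f y ∂μ) * ψ i x

omit [CompactSpace X] [MeasurableSpace X] [OpensMeasurableSpace X] in
/-- **the kernel is continuous on `X × X`** for continuous `φᵢ, ψᵢ` -/
theorem continuous_kernel (φ ψ : ι → X → ℂ) (hφ : ∀ i, Continuous (φ i)) (hψ : ∀ i, Continuous (ψ i)) :
    Continuous (Function.uncurry (kernel φ ψ)) := by
  have : Function.uncurry (kernel φ ψ) =
      fun p : X × X => ∑ i, ψ i p.1 * (starRingEnd ℂ) (φ i p.2) := by
    funext p
    rfl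
  rw [this]
  exact continuous_finsetSum _ fun i _ =>
    ((hψ i).comp continuous_fst).mul (Complex.continuous_conj.comp ((hφ i).comp continuous_snd))

omit [IsFiniteMeasure μ] in
/-- **the operator is the integral operator of the kernel**: `(T f)(x) = ∫ K(x, y) f(y) dμ(y)` for every
integrable `f` and every `x`. -/
theorem op_eq_integral_kernel (φ ψ : ι → X → ℂ) (hφ : ∀ i, Continuous (φ i)) (f : X → ℂ)
    (hf : Integrable f μ) (x : X) :
    op μ φ ψ f x = ∫ y, kernel φ ψ x y * f y ∂μ := by
  have e : (fun y => kernel φ ψ x y * f y) =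
      fun y => ∑ i, ψ i x * ((starRingEnd ℂ) (φ i y) * f y) := by
    funext y
    unfold kernel
    rw [sum_mul]
    refine sum_congr rfl fun i _ => ?_
    ring
  rw [e, integral_finsetSum]
  · unfold op
    refine sum_congr rfl fun i _ => ?_
    rw [integral_const_mul]
    ring
  · intro i _
    exact (integrable_continuous_mul μ _ f (Complex.continuous_conj.comp (hφ i)) hf).const_mul _

/-! ### The double period -/

/-- the inner integral of the double period -/
theorem integral_kernel_mul (φ ψ : ι → X → ℂ) (hφ : ∀ i, Continuous (φ i)) (wA wB : X → ℂ)
    (hB : Continuous wB) (x : X) :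
    ∫ y, kernel φ ψ x y * (wA x * wB y) ∂μ =
      ∑ i, (ψ i x * wA x) * ∫ y, (starRingEnd ℂ) (φ i y) * wB y ∂μ := by
  have e : (fun y => kernel φ ψ x y * (wA x * wB y)) =
      fun y => ∑ i, (ψ i x * wA x) * ((starRingEnd ℂ) (φ i y) * wB y) := by
    funext y
    unfold kernel
    rw [sum_mul]
    refine sum_congr rfl fun i _ => ?_
    ring
  rw [e, integral_finsetSum]
  · exact sum_congr rfl fun i _ => integral_const_mul _ _
  · intro i _
    exact (integrable_continuous_mul μ _ wB (Complex.continuous_conj.comp (hφ i))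
      (integrable_of_continuous μ wB hB)).const_mul _

/-- **the double period of a finite-rank kernel is a finite sum of products of periods**:
`∫∫ K(x, y) w_A(x) w_B(y) = ∑ᵢ (∫ ψᵢ w_A) (∫ conj φᵢ · w_B)`. -/
theorem double_integral_kernel (φ ψ : ι → X → ℂ) (hφ : ∀ i, Continuous (φ i)) (hψ : ∀ i, Continuous (ψ i))
    (wA wB : X → ℂ) (hA : Continuous wA) (hB : Continuous wB) :
    ∫ x, ∫ y, kernel φ ψ x y * (wA x * wB y) ∂μ ∂μ =
      ∑ i, (∫ x, ψ i x * wA x ∂μ) * ∫ y, (starRingEnd ℂ) (φ i y) * wB y ∂μ := by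
  simp_rw [integral_kernel_mul μ φ ψ hφ wA wB hB]
  rw [integral_finsetSum]
  · exact sum_congr rfl fun i _ => integral_mul_const _ _
  · intro i _
    exact (integrable_continuous_mul μ _ wA (hψ i) (integrable_of_continuous μ wA hA)).mul_const _

end Summit.Ventures.HodgeRepro2.T7SupportFiniteRankKernel
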